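import Summits.Ventures.CertifiedArithmetic.LowPrec.GemmEnvelopeTransfer

/-!
# GEMM-level envelopes, part (l): the masked-cell transfer for ANY element format (pub-lowprec gemm gen 22, LXX-l)

HONEST FRAMING: certified error envelopes and provably optimal rounding/accumulation schemes for
low-precision formats under stated cost models; every table by two implementations; no hardware or
vendor claims.

`GemmEnvelopeTransfer` proves `VEC-E4M3 ≼ MXC-E4M3` on `C(κ)` for every `κ ≥ 1` by reproducing each
per-vector product cell as an MX masked block pair.  Nothing in that argument is specific to E4M3: for any
element format `φ` with `0 < φ.maxRat =: M`, the per-vector path (numerator `A`, scale `A/M`, RNE into `φ`)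
and the MX path with the power-of-two CEIL scale (block maximum scaled into `(M/2, M]`) satisfy
`VEC-φ ≼ MX-φ-ceil` on `C(κ)` for every `κ ≥ 1` (blocks of length `≥ 3`): the masked blocks are
`(M, 0, y_a, 0, …)·(0, M, y_b, 0, …)` with `y = M·|x|/A`.  THEOREMS: `vec_cell_le_of_mx_bound_format`,
`row_vec_le_mxCeil_transfer_format`, and the E5M2 instance `row_vecE5M2_le_mxCeil_transfer` (the E4M3 one is
`row_vecE4M3_le_mxCeil_transfer` of part (k)).
[cite: RouhaniEtAl2023MX, §5.1, §6.3]; [cite: MicikeviciusEtAl2022, §3]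
-/

namespace Summit.Ventures.CertifiedArithmetic.LowPrec.GemmEnvelope

open Finset
open Literature.ComputerArithmetic.FloatingPoint
open Literature.ComputerArithmetic.FloatingPoint.Format
open Literature.ComputerArithmetic.FloatingPoint.MiniFloat
open Literature.ComputerArithmetic.FloatingPoint.MXBlock
open Summit.Ventures.CertifiedArithmetic.LowPrec.SR

/-- THE MASKED-CELL TRANSFER, any element format `φ` with `0 < φ.maxRat`: if `q` bounds the MX-φ (ceil scale)
GEMM error on `C(κ)` (blocks of length `n + 3`, `B ≥ 1` blocks), then `q` bounds the relative error of every
single per-vector-φ product cell whose operands satisfy the class constraints, for any `κ ≥ 1`.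
[cite: RouhaniEtAl2023MX, §6.3] -/
theorem vec_cell_le_of_mx_bound_format (φ : Format) (hMpos : 0 < φ.maxRat) {B n : ℕ} (hB : 0 < B) {κ : ℚ}
    (hκ : 1 ≤ κ) (q : ℚ)
    (hY : ∀ (a b : Fin B → Fin (n + 3) → ℚ) (Aa Ab : ℚ),
      (∀ j i, |a j i| ≤ Aa ∧ (a j i = 0 ∨ Aa ≤ κ * |a j i|)) →
      (∀ j i, |b j i| ≤ Ab ∧ (b j i = 0 ∨ Ab ≤ κ * |b j i|)) →
      |∑ j, ∑ i, (ceilScale φ (a j) * (roundNE φ (a j i / ceilScale φ (a j))).toRat) *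
          (ceilScale φ (b j) * (roundNE φ (b j i / ceilScale φ (b j))).toRat)
          - ∑ j, ∑ i, a j i * b j i| ≤ q * ∑ j, ∑ i, |a j i * b j i|)
    {a b Aa Ab : ℚ} (ha : |a| ≤ Aa ∧ (a = 0 ∨ Aa ≤ κ * |a|)) (hb : |b| ≤ Ab ∧ (b = 0 ∨ Ab ≤ κ * |b|)) :
    |(Aa / φ.maxRat * (roundNE φ (a / (Aa / φ.maxRat))).toRat) *
        (Ab / φ.maxRat * (roundNE φ (b / (Ab / φ.maxRat))).toRat) - a * b| ≤ q * |a * b| := by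
  by_cases ha0 : a = 0
  · rw [ha0, GemmEnvelope.scaled_zero φ (Aa / φ.maxRat)]; simp
  by_cases hb0 : b = 0
  · rw [hb0, GemmEnvelope.scaled_zero φ (Ab / φ.maxRat)]; simp
  have hapos : 0 < |a| := abs_pos.mpr ha0
  have hbpos : 0 < |b| := abs_pos.mpr hb0
  have hAa : 0 < Aa := lt_of_lt_of_le hapos ha.1
  have hAb : 0 < Ab := lt_of_lt_of_le hbpos hb.1
  set M : ℚ := φ.maxRat with hMdef
  set X : ℚ := Aa / M with hXdef
  set Y : ℚ := Ab / M with hYdef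
  have hX : 0 < X := by positivity
  have hYp : 0 < Y := by positivity
  set ya : ℚ := |a| / X with hya
  set yb : ℚ := |b| / Y with hyb
  have hya0 : 0 < ya := by positivity
  have hyb0 : 0 < yb := by positivity
  have hXe : X * M = Aa := by rw [hXdef, div_mul_cancel₀ Aa (ne_of_gt hMpos)]
  have hYe : Y * M = Ab := by rw [hYdef, div_mul_cancel₀ Ab (ne_of_gt hMpos)]
  have hyaM : ya ≤ M := by
    rw [hya, div_le_iff₀ hX, mul_comm, hXe]; exact ha.1
  have hybM : yb ≤ M := by
    rw [hyb, div_le_iff₀ hYp, mul_comm, hYe]; exact hb.1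
  have hκa : M ≤ κ * ya := by
    have h1 : Aa ≤ κ * |a| := ha.2.resolve_left ha0
    rw [hya, mul_div_assoc', le_div_iff₀ hX, mul_comm M X, hXe]; exact h1
  have hκb : M ≤ κ * yb := by
    have h1 : Ab ≤ κ * |b| := hb.2.resolve_left hb0
    rw [hyb, mul_div_assoc', le_div_iff₀ hYp, mul_comm M Y, hYe]; exact h1
  have hκM : M ≤ κ * M := by
    have := mul_le_mul_of_nonneg_right hκ hMpos.le
    linarith
  have hMp : (0 : ℚ) < M := hMpos
  -- the MX witness blocks
  set a' : Fin (n + 3) → ℚ :=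
    Fin.cases M (Fin.cases (0 : ℚ) (Fin.cases ya (fun _ : Fin n => (0 : ℚ)))) with ha'
  set b' : Fin (n + 3) → ℚ :=
    Fin.cases (0 : ℚ) (Fin.cases M (Fin.cases yb (fun _ : Fin n => (0 : ℚ)))) with hb'
  have haM : ∀ i, |a' i| ≤ M := by
    intro i; rw [ha']
    refine Fin.cases ?_ (fun i₁ => Fin.cases ?_ (fun i₂ => Fin.cases ?_ (fun _ => ?_) i₂) i₁) i
    · simp only [Fin.cases_zero]; rw [abs_of_pos hMp]
    · simp only [Fin.cases_succ, Fin.cases_zero, abs_zero]; exact hMp.le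
    · simp only [Fin.cases_succ, Fin.cases_zero]; rwa [abs_of_pos hya0]
    · simp only [Fin.cases_succ, abs_zero]; exact hMp.le
  have hbM : ∀ i, |b' i| ≤ M := by
    intro i; rw [hb']
    refine Fin.cases ?_ (fun i₁ => Fin.cases ?_ (fun i₂ => Fin.cases ?_ (fun _ => ?_) i₂) i₁) i
    · simp only [Fin.cases_zero, abs_zero]; exact hMp.le
    · simp only [Fin.cases_succ, Fin.cases_zero]; rw [abs_of_pos hMp]
    · simp only [Fin.cases_succ, Fin.cases_zero]; rwa [abs_of_pos hyb0]
    · simp only [Fin.cases_succ, abs_zero]; exact hMp.le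
  have hmemA : ∀ (j : Fin B) (i : Fin (n + 3)), |(fun _ : Fin B => a') j i| ≤ M ∧
      ((fun _ : Fin B => a') j i = 0 ∨ M ≤ κ * |(fun _ : Fin B => a') j i|) := by
    intro j i; refine ⟨haM i, ?_⟩
    show a' i = 0 ∨ M ≤ κ * |a' i|
    rw [ha']
    refine Fin.cases ?_ (fun i₁ => Fin.cases ?_ (fun i₂ => Fin.cases ?_ (fun _ => ?_) i₂) i₁) i
    · simp only [Fin.cases_zero]; rw [abs_of_pos hMp]; exact Or.inr hκM
    · simp only [Fin.cases_succ, Fin.cases_zero]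
      first | exact Or.inl rfl | exact Or.inl trivial
    · simp only [Fin.cases_succ, Fin.cases_zero]; rw [abs_of_pos hya0]; exact Or.inr hκa
    · simp only [Fin.cases_succ]
      first | exact Or.inl rfl | exact Or.inl trivial
  have hmemB : ∀ (j : Fin B) (i : Fin (n + 3)), |(fun _ : Fin B => b') j i| ≤ M ∧
      ((fun _ : Fin B => b') j i = 0 ∨ M ≤ κ * |(fun _ : Fin B => b') j i|) := by
    intro j i; refine ⟨hbM i, ?_⟩
    show b' i = 0 ∨ M ≤ κ * |b' i|
    rw [hb']
    refine Fin.cases ?_ (fun i₁ => Fin.cases ?_ (fun i₂ => Fin.cases ?_ (fun _ => ?_) i₂) i₁) i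
    · simp only [Fin.cases_zero]
      first | exact Or.inl rfl | exact Or.inl trivial
    · simp only [Fin.cases_succ, Fin.cases_zero]; rw [abs_of_pos hMp]; exact Or.inr hκM
    · simp only [Fin.cases_succ, Fin.cases_zero]; rw [abs_of_pos hyb0]; exact Or.inr hκb
    · simp only [Fin.cases_succ]
      first | exact Or.inl rfl | exact Or.inl trivial
  -- block maxima `M` pin both ceil scales to `1`
  have hbmA : blockMax a' = M :=
    blockMax_eq_of_forall_le haM (i₀ := 0) (by rw [ha']; simp only [Fin.cases_zero]; rw [abs_of_pos hMp])
  have hbmB : blockMax b' = M :=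
    blockMax_eq_of_forall_le hbM (i₀ := 1)
      (by rw [hb']; simp only [show (1 : Fin (n + 3)) = (0 : Fin (n + 2)).succ from rfl, Fin.cases_succ,
        Fin.cases_zero]; rw [abs_of_pos hMp])
  have hsA : ceilScale φ a' = 1 := by
    have h := ceilScale_eq_zpow hMpos (V := a') (e := 0) (by rw [hbmA]; simp only [zpow_zero, one_mul]; linarith)
      (by rw [hbmA]; simp only [zpow_zero, one_mul]; exact le_rfl)
    rw [h]; norm_num
  have hsB : ceilScale φ b' = 1 := by
    have h := ceilScale_eq_zpow hMpos (V := b') (e := 0) (by rw [hbmB]; simp only [zpow_zero, one_mul]; linarith)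
      (by rw [hbmB]; simp only [zpow_zero, one_mul]; exact le_rfl)
    rw [h]; norm_num
  -- the three block sums of the witness
  set Qa : ℚ := (roundNE φ ya).toRat with hQa
  set Qb : ℚ := (roundNE φ yb).toRat with hQb
  have hS1 : ∑ i, (roundNE φ (a' i)).toRat * (roundNE φ (b' i)).toRat = Qa * Qb := by
    rw [Fin.sum_univ_succ, Fin.sum_univ_succ, Fin.sum_univ_succ, ha', hb', hQa, hQb]
    simp only [Fin.cases_zero, Fin.cases_succ, toRat_roundNE_zero, mul_zero, zero_mul, zero_add, add_zero,
      sum_const_zero]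
  have hS2 : ∑ i, a' i * b' i = ya * yb := by
    rw [Fin.sum_univ_succ, Fin.sum_univ_succ, Fin.sum_univ_succ, ha', hb']
    simp only [Fin.cases_zero, Fin.cases_succ, mul_zero, zero_mul, zero_add, add_zero, sum_const_zero]
  have hS3 : ∑ i, |a' i * b' i| = ya * yb := by
    rw [Fin.sum_univ_succ, Fin.sum_univ_succ, Fin.sum_univ_succ, ha', hb']
    simp only [Fin.cases_zero, Fin.cases_succ, mul_zero, zero_mul, abs_zero, zero_add, add_zero,
      sum_const_zero, abs_of_pos (mul_pos hya0 hyb0)]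
  have hw := hY (fun _ => a') (fun _ => b') M M hmemA hmemB
  simp only [hsA, hsB, div_one, one_mul, hS1, hS2, hS3, sum_const, card_univ, Fintype.card_fin,
    nsmul_eq_mul] at hw
  -- strip the factor `B`
  have hBq : (0 : ℚ) < (B : ℚ) := by exact_mod_cast hB
  have hcell : |Qa * Qb - ya * yb| ≤ q * (ya * yb) := by
    have e1 : (B : ℚ) * (Qa * Qb) - (B : ℚ) * (ya * yb) = (B : ℚ) * (Qa * Qb - ya * yb) := by ring
    rw [e1, abs_mul, abs_of_pos hBq] at hw
    have e2 : q * ((B : ℚ) * (ya * yb)) = (B : ℚ) * (q * (ya * yb)) := by ring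
    rw [e2] at hw
    exact le_of_mul_le_mul_left hw hBq
  -- back to the per-vector cell through the sign normal forms
  obtain ⟨σa, hσa, hae, hqa⟩ := scaled_sign_form φ X a
  obtain ⟨σb, hσb, hbe, hqb⟩ := scaled_sign_form φ Y b
  have haX : |a| = X * ya := by rw [hya]; field_simp
  have hbY : |b| = Y * yb := by rw [hyb]; field_simp
  have hab : a * b = σa * σb * (X * Y) * (ya * yb) := by
    calc a * b = (σa * |a|) * (σb * |b|) := by rw [← hae, ← hbe]
      _ = σa * σb * (X * Y) * (ya * yb) := by rw [haX, hbY]; ring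
  have hXY : 0 < X * Y := mul_pos hX hYp
  have hprod : X * (roundNE φ (a / X)).toRat * (Y * (roundNE φ (b / Y)).toRat) - a * b
      = σa * σb * (X * Y) * (Qa * Qb - ya * yb) := by
    rw [hqa, hqb, ← hya, ← hyb, ← hQa, ← hQb, hab]; ring
  have habs : |a * b| = X * Y * (ya * yb) := by
    rw [hab, abs_mul, abs_mul, abs_mul, hσa, hσb, abs_of_pos hXY, abs_of_pos (mul_pos hya0 hyb0)]; ring
  rw [hprod, habs, abs_mul, abs_mul, abs_mul, hσa, hσb, abs_of_pos hXY, one_mul, one_mul]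
  nlinarith [mul_le_mul_of_nonneg_left hcell hXY.le]

/-- **`VEC-φ ≼ MX-φ-ceil` ON `C(κ)` FOR EVERY `κ ≥ 1`, ANY ELEMENT FORMAT** (blocks of length `≥ 3`, exact
accumulation): every `q` bounding the MX ceil-scale GEMM error on `C(κ)` bounds the per-vector GEMM error on
`C(κ)` — by the masked-cell transfer, cell by cell. [cite: RouhaniEtAl2023MX, §5.1, §6.3] -/
theorem row_vec_le_mxCeil_transfer_format (φ : Format) (hMpos : 0 < φ.maxRat) {B k : ℕ} (hB : 0 < B)
    (hk : 3 ≤ k) {κ : ℚ} (hκ : 1 ≤ κ) (q : ℚ)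
    (hY : ∀ (a b : Fin B → Fin k → ℚ) (Aa Ab : ℚ),
      (∀ j i, |a j i| ≤ Aa ∧ (a j i = 0 ∨ Aa ≤ κ * |a j i|)) →
      (∀ j i, |b j i| ≤ Ab ∧ (b j i = 0 ∨ Ab ≤ κ * |b j i|)) →
      |∑ j, ∑ i, (ceilScale φ (a j) * (roundNE φ (a j i / ceilScale φ (a j))).toRat) *
          (ceilScale φ (b j) * (roundNE φ (b j i / ceilScale φ (b j))).toRat)
          - ∑ j, ∑ i, a j i * b j i| ≤ q * ∑ j, ∑ i, |a j i * b j i|)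
    (a b : Fin B → Fin k → ℚ) (Aa Ab : ℚ)
    (ha : ∀ j i, |a j i| ≤ Aa ∧ (a j i = 0 ∨ Aa ≤ κ * |a j i|))
    (hb : ∀ j i, |b j i| ≤ Ab ∧ (b j i = 0 ∨ Ab ≤ κ * |b j i|)) :
    |∑ j, ∑ i, (Aa / φ.maxRat * (roundNE φ (a j i / (Aa / φ.maxRat))).toRat) *
        (Ab / φ.maxRat * (roundNE φ (b j i / (Ab / φ.maxRat))).toRat)
        - ∑ j, ∑ i, a j i * b j i| ≤ q * ∑ j, ∑ i, |a j i * b j i| := by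
  obtain ⟨n, rfl⟩ : ∃ n, k = n + 3 := ⟨k - 3, by omega⟩
  have hcell : ∀ j i,
      |(Aa / φ.maxRat * (roundNE φ (a j i / (Aa / φ.maxRat))).toRat) *
          (Ab / φ.maxRat * (roundNE φ (b j i / (Ab / φ.maxRat))).toRat) - a j i * b j i|
        ≤ q * |a j i * b j i| :=
    fun j i => vec_cell_le_of_mx_bound_format φ hMpos hB hκ q hY (ha j i) (hb j i)
  rw [← sum_sub_distrib]
  simp_rw [← sum_sub_distrib]
  refine le_trans (abs_sum_le_sum_abs _ _) ?_
  refine le_trans (sum_le_sum fun j _ => abs_sum_le_sum_abs _ _) ?_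
  rw [mul_sum]
  refine sum_le_sum fun j _ => ?_
  rw [mul_sum]
  exact sum_le_sum fun i _ => hcell j i


/-- `0 < E5M2.maxRat` (`= 57344`). -/
theorem E5M2_maxRat_pos : 0 < E5M2.maxRat := by
  have h : E5M2.maxRat = 57344 := by decide +kernel
  rw [h]; norm_num

/-- The E5M2 instance: **`VEC-E5M2 ≼ MX-E5M2-ceil` on `C(κ)` for every `κ ≥ 1`** (blocks `≥ 3`).
[cite: MicikeviciusEtAl2022, §3] -/
theorem row_vecE5M2_le_mxCeil_transfer {B k : ℕ} (hB : 0 < B) (hk : 3 ≤ k) {κ : ℚ} (hκ : 1 ≤ κ) (q : ℚ)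
    (hY : ∀ (a b : Fin B → Fin k → ℚ) (Aa Ab : ℚ),
      (∀ j i, |a j i| ≤ Aa ∧ (a j i = 0 ∨ Aa ≤ κ * |a j i|)) →
      (∀ j i, |b j i| ≤ Ab ∧ (b j i = 0 ∨ Ab ≤ κ * |b j i|)) →
      |∑ j, ∑ i, (ceilScale E5M2 (a j) * (roundNE E5M2 (a j i / ceilScale E5M2 (a j))).toRat) *
          (ceilScale E5M2 (b j) * (roundNE E5M2 (b j i / ceilScale E5M2 (b j))).toRat)
          - ∑ j, ∑ i, a j i * b j i| ≤ q * ∑ j, ∑ i, |a j i * b j i|)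
    (a b : Fin B → Fin k → ℚ) (Aa Ab : ℚ)
    (ha : ∀ j i, |a j i| ≤ Aa ∧ (a j i = 0 ∨ Aa ≤ κ * |a j i|))
    (hb : ∀ j i, |b j i| ≤ Ab ∧ (b j i = 0 ∨ Ab ≤ κ * |b j i|)) :
    |∑ j, ∑ i, (Aa / E5M2.maxRat * (roundNE E5M2 (a j i / (Aa / E5M2.maxRat))).toRat) *
        (Ab / E5M2.maxRat * (roundNE E5M2 (b j i / (Ab / E5M2.maxRat))).toRat)
        - ∑ j, ∑ i, a j i * b j i| ≤ q * ∑ j, ∑ i, |a j i * b j i| :=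
  row_vec_le_mxCeil_transfer_format E5M2 E5M2_maxRat_pos hB hk hκ q hY a b Aa Ab ha hb

end Summit.Ventures.CertifiedArithmetic.LowPrec.GemmEnvelope
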